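import Summits.HodgeConjecture.HodgeConjecture.Theorems.K2LiuDoublingHeightArchSlice             -- ★ (B∞) (p857165): `doublingHeightArchSlice`
import Summits.HodgeConjecture.HodgeConjecture.Theorems.K2LiuDoublingHeightDecayLocalOfSlices     -- ★ (R) (p856795, K2Liu-p05): `doublingHeightDecayLocal_of_slices`
import HarnessLib

/-!
# Crux `HLiu418`, Track B road `K2_Liu`, unit U5d, socket #32dR `sig_K2LiuDoublingHeightDecayLocalR2` MODULO ITS FINITE SLICES:
# with the archimedean slice ★ (B∞) discharged, #32dR follows from the integrability of its `v`-slices, `v ∈ S`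

Cell `hodgecm-mathlib`, crux item hLiu418 = `stmt-HodgeConjecture-24832`, route of record `HCCMUnconditional`; squad K2 ∕ K2Liu, LEAD F0P6-plan (g11), typist
K2Liu-plan (g3), prover K2Liu-p02 (g3) (offer (α) 03:52:36Z; #32dR is K2Liu-p05's lineage — this file takes no slice from it).  THEOREMS ONLY; lane
`--supports stmt-HodgeConjecture-24832 --as helper` (count-neutral).

WHAT IS PROVED.  **`doublingHeightDecayLocalR2_of_finSlices`** — the statement of socket #32dR (`Cruxes/HLiu418/Lines/K2_Liu_CurveThetaSigs_U5d_ZetaS.lean` ED. 5 :554,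
binders :555–:581 TOKEN FOR TOKEN) with ONE extra hypothesis after `_hτ`: the finite slices
`_hfin : ∀ v : S, Integrable (fun u => Φ (iotaLeft L e dV hdV dW hdW (ιA (placesEmbed L H S (1, Pi.mulSingle v u)))) ^ τ) (νS v)`
(the `_hfin` of ★ (R) `doublingHeightDecayLocal_of_slices`, verbatim at `N = 2`).  Proof: ★ (R) at `N := 2` with `_harch := ` ★ (B∞) `doublingHeightArchSlice`.
So the payer of #32dR is this theorem applied to the finite slices ((Bv-split) ★∕📤 K2Liu-p05, (Bv-nonsplit) after row 26), and K2Liu-p09's #34 assembler may consume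
#32dR through it with one named input per finite place type. [cite: GelbartPiatetskishapiroRallis1987, Part A §2, §6] [cite: Liu2011, §2B Prop. 2.3 p. 862]

HONEST LABEL.  `HC_CM` is proved only modulo the 7 printed citations (2 remaining named inputs: hLiu418 = `stmt-HodgeConjecture-24832`, h413 =
`stmt-HodgeConjecture-24833`) until rung 0 closes; this file is bookkeeping toward socket #32dR and retires nothing by itself.
-/

set_option autoImplicit false
-- the mandated namespace repeats the single-problem summit's segment (`HodgeConjecture.HodgeConjecture`)
set_option linter.dupNamespace false

noncomputable section

open scoped Matrix ComplexOrder
open MeasureTheory NumberField NumberField.InfinitePlace IsDedekindDomain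

namespace Summit.HodgeConjecture.HodgeConjecture.Cruxes.HLiu418.K2LiuDoublingHeightDecayLocalR2OfFinSlices

open Literature.NumberTheory.Automorphic Literature.NumberTheory.Automorphic.UnitaryGroup
open Literature.NumberTheory.GelbartRogawski1991 Literature.NumberTheory.GelbartRogawski1991.GRConstruction
open Literature.NumberTheory.K2Lit.SiegelDoubled Literature.NumberTheory.K2Lit.PlaceSplitting
open Summit.HodgeConjecture.HodgeConjecture.Cruxes.HLiu418.K2LiuDoublingHeightArchSlice
open Summit.HodgeConjecture.HodgeConjecture.Cruxes.HLiu418.K2LiuDoublingHeightDecayLocalOfSlices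

/-- **SOCKET #32dR MODULO ITS FINITE SLICES.**  Under the binders of `sig_K2LiuDoublingHeightDecayLocalR2` (U5d ED. 5 :554, verbatim) and the integrability of the
`v`-slices `u ↦ Φ(ι(ιA(placesEmbed(1, (u at v))), 1))^τ` for `v ∈ S`, the socket's conclusion holds: `x ↦ Φ(ι(ιA(placesEmbed x), 1))^τ` is integrable for
`ν_∞ ⊗ ⊗_{v∈S} ν_v` — ★ (R) `doublingHeightDecayLocal_of_slices` at `N = 2` with its archimedean hypothesis discharged by ★ (B∞) `doublingHeightArchSlice` (`τ > 2`).
[cite: GelbartPiatetskishapiroRallis1987, Part A §2, §6] [cite: Liu2011, §2B Prop. 2.3 p. 862] [cite: BorelJacquet1979, §1.2, §4.1] -/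
theorem doublingHeightDecayLocalR2_of_finSlices :
    ∀ (L : Type) [Field L] [NumberField L] [IsCMField L] {n : ℕ} (e : Fin 2 × Fin 1 ≃ Fin n)
      (dV : Fin 2 → L) (hdV : ∀ i, IsCMField.complexConj L (dV i) = dV i) (_hdV0 : ∀ i, dV i ≠ 0)
      (ι : L →+* ℂ) (_hpos : ∀ τ' : L →+* ℂ, InfinitePlace.mk τ' ≠ InfinitePlace.mk ι → ((Matrix.diagonal dV).map τ').PosDef)
      (dW : Fin 1 → L) (hdW : ∀ i, IsCMField.complexConj L (dW i) = dW i) (_hdW0 : ∀ i, dW i ≠ 0)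
      (H : Matrix (Fin 2) (Fin 2) L)
      (t : L) (_ht : t ≠ 0) (g : GL (Fin 2) L)
      (_hg : formCongr ((IsCMField.complexConj L : L ≃ₐ[↥(maximalRealSubfield L)] L) : L →+* L) g (t • H) = Matrix.diagonal dV)
      (ιA : (UnitaryGroup.adelicGroupData (Fp L) L (IsCMField.complexConj L) 2 H).Adelic →*
        UnitaryGroup.adelic (Fp L) L (IsCMField.complexConj L) 2 (Matrix.diagonal dV))
      (_hιA : ∀ k, ((ιA k : ↥(UnitaryGroup.adelic (Fp L) L (IsCMField.complexConj L) 2 (Matrix.diagonal dV))) :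
            GL (Fin 2) (AdeleRing (𝓞 L) L)) =
          (toAdeleGL L g)⁻¹ * UnitaryGroup.adelicVal (Fp L) L (IsCMField.complexConj L) 2 H k * toAdeleGL L g)
      (S : Finset (HeightOneSpectrum (𝓞 (Fp L)))) [DecidableEq (HeightOneSpectrum (𝓞 (Fp L)))]
      [MeasurableSpace (UnitaryGroup.arch (Fp L) L (IsCMField.complexConj L) 2 H)]
      [BorelSpace (UnitaryGroup.arch (Fp L) L (IsCMField.complexConj L) 2 H)]
      [∀ v : HeightOneSpectrum (𝓞 (Fp L)), MeasurableSpace (UnitaryGroup.localPi L (IsCMField.complexConj L) 2 H v)]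
      [∀ v : HeightOneSpectrum (𝓞 (Fp L)), BorelSpace (UnitaryGroup.localPi L (IsCMField.complexConj L) 2 H v)]
      (νinf : Measure (UnitaryGroup.arch (Fp L) L (IsCMField.complexConj L) 2 H)) [νinf.IsHaarMeasure]
      (νS : ∀ v : S, Measure (UnitaryGroup.localPi L (IsCMField.complexConj L) 2 H v.1)) [∀ v, (νS v).IsHaarMeasure]
      (Φ : HA L e dV hdV dW hdW → ℝ) (_hΦc : Continuous Φ) (_hΦpos : ∀ x, 0 < Φ x)
      (_hΦ : ∀ p x : HA L e dV hdV dW hdW, IsSiegelDelta L e dV hdV dW hdW p →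
        Φ (p * x) = modDelta L e dV hdV dW hdW p * Φ x)
      (τ : ℝ) (_hτ : 2 * (2 : ℝ) - 2 < τ)
      -- the finite slices, one for each `v ∈ S` (the `_hfin` of ★ (R), verbatim at `N = 2`)
      (_hfin : ∀ v : S, Integrable
        (fun u => Φ (iotaLeft L e dV hdV dW hdW (ιA (placesEmbed L H S (1, Pi.mulSingle v u)))) ^ τ) (νS v)),
      Integrable (fun x => Φ (iotaLeft L e dV hdV dW hdW (ιA (placesEmbed L H S x))) ^ τ) (νinf.prod (Measure.pi νS)) := by
  intro L _ _ _ n e dV hdV hdV0 ι hpos dW hdW hdW0 H t ht g hg ιA hιA S _ _ _ _ _ νinf _ νS _ Φ hΦc hΦpos hΦ τ hτ hfin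
  exact doublingHeightDecayLocal_of_slices L e dV hdV hdV0 dW hdW hdW0 H t ht g hg ιA hιA S νinf νS Φ hΦc hΦpos hΦ τ
    (doublingHeightArchSlice L e dV hdV hdV0 ι hpos dW hdW hdW0 H t ht g hg ιA hιA S νinf Φ hΦc hΦpos hΦ τ hτ) hfin

end Summit.HodgeConjecture.HodgeConjecture.Cruxes.HLiu418.K2LiuDoublingHeightDecayLocalR2OfFinSlices

end
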